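/-
Copyright (c) 2026 the pub-hodgecm-mathlib formalisation cell (harness21).  Prover seat hodgecm-mathlib-F0P3-p03 (g15): road «S3-ram» (LEAD F0P3a-plan (g12∕g13); owner
F0P3a-p06 (g15)); junction J-PACK v2-iso (pen F0P3a-p01 (g17); S45 hand F0P3a-p02 (g17)), rows SHAPE ∕ LINE TEST of the isoceles wave (file 3 of 3); 2026-09-02.
-/
import Literature.NumberTheory.Automorphic.UnitaryLatticeTreeIsocelesRegionDistanceRamified   -- ★ p847820 (this seat; brings ★ p847753 the criterion, ★ p847610 frames)
import HarnessLib

/-!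
# The lattice graph of a hermitian space — THE ISOCELES REGION: THE VALUE SHAPE ON A REGION VERTEX AND THE ALL-OR-NONE LINE TEST (tame-ramified place)
# (Bruhat–Tits 1972 §10; Kottwitz 1986 §3; Serre, *Trees* II.1.1)

Topic `NumberTheory/Automorphic`; namespace `Literature.NumberTheory.Automorphic.UnitaryLatticeTree`.  THEOREMS ONLY (no definition, no instance, no notation, no named fact,
no `sorry`); kernel lane `--supports stmt-HodgeConjecture-24833`.  Cell `pub/hodgecm-mathlib` (D-0151), crux H413; road «S3-ram» (Literature seeding, count-neutral); junction
(J★), ISOCELES wave (S45 hand F0P3a-p02 (g17): «SHAPE as a head — yes please» 2026-09-02T02:07Z; pen F0P3a-p01 (g17): «the all-or-none far side of a child is p03's lattice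
half» 01:58Z).  Sequel of ★ `…IsocelesRegionCriterionRamified` (REGION CRITERION: self-dual `M` has `LEV[M](ϖ^{d₀})` iff `u_{i₀} ∈ M ∧ ϖ^{s'}u_k ∈ M`) and ★
`…IsocelesRegionDistanceRamified` (DIST).  Notation as there (`u_m = A e_m`, `c(z) = A⁻¹z`, Gram `diag(d)∕(−det diag d) =: κ₀·diag(d)`).

§7 THE VALUE SHAPE (exact, frame-free).  With the two INTEGRAL linear forms of a region vertex `λ(x) = ⟨u_{i₀}, x⟩` and `μ(x) = ⟨ϖ^{s'}u_k, x⟩`: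
**`⟨x, (γ−1)x⟩ − (s_j − 1)·⟨x, x⟩ = α·λ(x)σ(λ(x)) + β·μ(x)σ(μ(x))`** for ALL `x ∈ K³`, with `α = (s_{i₀} − s_j)∕(σκ₀·σd_{i₀})`, `β = (s_k − s_j)∕((σϖ·ϖ)^{s'}·σκ₀·σd_k)`,
`|α| = |β| = |ϖ|^{d₀}` — so on a residually isotropic line `x̄` of a region vertex `v` the depth-`d₀` value is the binary form `ᾱ'·λ̄(x̄)² + β̄'·μ̄(x̄)²` in the residual linear
forms `λ̄, μ̄` of `v∕ϖv` (`μ̄ ≢ 0` iff `ϖ^{s'−1}u_k ∉ v` iff `dist(r₀, v) = 2s'`: the END vertices), the `(c, l)`-shape consumed by the S45 vertex-frame census.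
§8 THE LINE TEST («all `q` digits or none»).  `v` a region vertex, `x ∈ v`, `w ≠ v` a self-dual vertex containing the child `c_x = {z ∈ v | |⟨x, z⟩| < 1}`: then
`w ∩ v = c_x` (a vector of `v ∩ w` off `c_x` would drag all of `v` into `w`), hence **`LEV[w](ϖ^{d₀}) ↔ |⟨x, u_{i₀}⟩| < 1 ∧ |⟨x, ϖ^{s'}u_k⟩| < 1`** — the far side of the child
through `x̄` is in the region iff `x̄ ∈ ker λ̄ ∩ ker μ̄`, independently of the digit.  §9 the two spellings of the root-plane hyperbolicity token agree.

* §7 **`pairing_sub_one_mulVec_sub_eq_norm_add_norm`**, `v_shapeCoeff_i₀_eq`, `v_shapeCoeff_k_eq`.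
* §8 `v_pairing_lt_one_of_mem_inter_of_child_le`, **`lev_iff_v_pairing_lt_one_of_child_le`** (LINE TEST).
* §9 `exists_v_eq_one_iff_exists_v_le_one`.

HONEST LABEL: HC_CM is proved only modulo the 2 remaining named inputs (hLiu418 24832, h413 24833) until rung 0 closes; nothing printed is asserted here (module algebra over a
valuation ring); «S3-ram» has no books consequence.

## References
* [BruhatTits1972] F. Bruhat, J. Tits, *Groupes réductifs sur un corps local I*, Publ. Math. IHÉS 41 (1972), §10 (lattice models of the rank-one building; fixed points of tori).
* [Kottwitz1986] R. E. Kottwitz, *Base change for unit elements of Hecke algebras*, Compositio Math. 60 (1986), §3 (fixed lattices of a torus element).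
* [Serre1980Trees] J.-P. Serre, *Trees* (1980), Ch. II §1.1 (lattices, neighbours).
* [Tits1979] J. Tits, *Reductive groups over local fields*, PSPM 33.1 (1979), §3.5.
-/

set_option autoImplicit false

noncomputable section

open scoped Valued WithZero Matrix MatrixGroups

namespace Literature.NumberTheory.Automorphic.UnitaryLatticeTree

open Literature.NumberTheory.Automorphic Literature.NumberTheory.Automorphic.HermitianLattice

variable {K : Type*} [Field K] [Valued K ℤᵐ⁰] {σ : K →+* K} {ϖ : K}

/-! ## §7 The value shape: `⟨x,(γ−1)x⟩ − (s_j−1)⟨x,x⟩` is a sum of two norms of linear forms -/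

omit [Valued K ℤᵐ⁰] in
/-- **THE VALUE SHAPE (exact).**  `γ = A·diag(s)·A⁻¹` with Gram `κ₀·diag(d)` (`κ₀ = (−det diag d)⁻¹`, `d_m ≠ 0`), `σ` an involution, indices `{i₀, j, k} = Fin 3`: for every
`x ∈ K³`, `⟨x, (γ−1)x⟩ − (s_j − 1)·⟨x, x⟩ = α·λ(x)·σ(λ(x)) + β·μ(x)·σ(μ(x))` with `λ(x) = ⟨A e_{i₀}, x⟩`, `μ(x) = ⟨ϖ^{s'}A e_k, x⟩`, `α = (s_{i₀} − s_j)∕(σκ₀·σd_{i₀})`,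
`β = (s_k − s_j)∕((σϖ·ϖ)^{s'}·σκ₀·σd_k)` (the `u_j`-coordinate drops out). [cite: Kottwitz1986, §3] [cite: BruhatTits1972, §10] -/
theorem pairing_sub_one_mulVec_sub_eq_norm_add_norm (hσ : ∀ x, σ (σ x) = x) (hϖ0 : ϖ ≠ 0) (A : GL (Fin 3) K) {d : Fin 3 → K} (hd0 : ∀ i, d i ≠ 0)
    (hdA : Matrix.diagonal d = (-(Matrix.diagonal d).det) • formCongr σ A ((StdForm.antidiagonal 3).over K))
    (s : Fin 3 → K) {γm : Matrix (Fin 3) (Fin 3) K} (hγA : γm = (A : Matrix (Fin 3) (Fin 3) K) * Matrix.diagonal s * ((A⁻¹ : GL (Fin 3) K) : Matrix (Fin 3) (Fin 3) K))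
    {i₀ j k : Fin 3} (hj : j ≠ i₀) (hk : k ≠ i₀) (hjk : j ≠ k) (s' : ℕ) (x : Fin 3 → K) :
    pairing σ ((StdForm.antidiagonal 3).over K) x ((γm - 1) *ᵥ x) - (s j - 1) * pairing σ ((StdForm.antidiagonal 3).over K) x x =
      (s i₀ - s j) / (σ ((-(Matrix.diagonal d).det)⁻¹) * σ (d i₀)) *
          (pairing σ ((StdForm.antidiagonal 3).over K) ((A : Matrix (Fin 3) (Fin 3) K) *ᵥ Pi.single i₀ 1) x *
            σ (pairing σ ((StdForm.antidiagonal 3).over K) ((A : Matrix (Fin 3) (Fin 3) K) *ᵥ Pi.single i₀ 1) x)) +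
        (s k - s j) / ((σ ϖ * ϖ) ^ s' * σ ((-(Matrix.diagonal d).det)⁻¹) * σ (d k)) *
          (pairing σ ((StdForm.antidiagonal 3).over K) (ϖ ^ s' • ((A : Matrix (Fin 3) (Fin 3) K) *ᵥ Pi.single k 1)) x *
            σ (pairing σ ((StdForm.antidiagonal 3).over K) (ϖ ^ s' • ((A : Matrix (Fin 3) (Fin 3) K) *ᵥ Pi.single k 1)) x)) := by
  have hdet : -(Matrix.diagonal d).det ≠ 0 := by
    rw [neg_ne_zero, Matrix.det_diagonal]; exact Finset.prod_ne_zero_iff.2 fun i _ => hd0 i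
  set κ₀ : K := (-(Matrix.diagonal d).det)⁻¹ with hκ₀
  have hκ0 : κ₀ ≠ 0 := inv_ne_zero hdet
  have hσκ0 : σ κ₀ ≠ 0 := fun h => hκ0 (by rw [← hσ κ₀, h, map_zero])
  have hσd : ∀ m, σ (d m) ≠ 0 := fun m h => hd0 m (by rw [← hσ (d m), h, map_zero])
  have hσϖ0 : σ ϖ ≠ 0 := fun h => hϖ0 (by rw [← hσ ϖ, h, map_zero])
  set c : Fin 3 → K := (((A⁻¹ : GL (Fin 3) K) : Matrix (Fin 3) (Fin 3) K)) *ᵥ x with hc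
  -- LHS: `⟨x, (γ−1)x − (s_j−1)x⟩ = ⟨A c, A w⟩`
  have hlhs : pairing σ ((StdForm.antidiagonal 3).over K) x ((γm - 1) *ᵥ x) - (s j - 1) * pairing σ ((StdForm.antidiagonal 3).over K) x x =
      κ₀ * ∑ i, σ (c i) * d i * ((s i - s j) * c i) := by
    rw [← smul_eq_mul (s j - 1), ← map_smul, ← map_sub, sub_one_mulVec_sub_smul_eq A s hγA j x, ← hc]
    conv_lhs => rw [← coe_mulVec_inv_mulVec A x, ← hc]
    rw [pairing_coe_mulVec_coe_mulVec_eq_sum A hd0 hdA]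
  rw [hlhs, sum_eq_add_add_of_ne _ hj hk hjk, LinearMap.map_smulₛₗ₂, smul_eq_mul, pairing_single_coe_mulVec_eq A hd0 hdA i₀ x, pairing_single_coe_mulVec_eq A hd0 hdA k x, ← hc,
    ← hκ₀]
  simp only [map_mul, map_pow, hσ, sub_self, zero_mul, mul_zero, add_zero]
  have hσdi := hσd i₀
  have hσdk := hσd k
  field_simp
  ring

/-- The `i₀`-coefficient of the value shape has valuation `|ϖ|^{d₀}` (unit Gram, isolated gap `|s_{i₀} − s_j| = |ϖ|^{d₀}`). [cite: Kottwitz1986, §3] -/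
theorem v_shapeCoeff_i₀_eq (hvσ : ∀ a, Valued.v (σ a) = Valued.v a) {d : Fin 3 → K} (hd : ∀ i, Valued.v (d i) = 1) (s : Fin 3 → K)
    {i₀ j : Fin 3} (hj : j ≠ i₀) {d₀ : ℕ} (hiso : ∀ m, m ≠ i₀ → Valued.v (s i₀ - s m) = Valued.v ϖ ^ d₀) :
    Valued.v ((s i₀ - s j) / (σ ((-(Matrix.diagonal d).det)⁻¹) * σ (d i₀))) = Valued.v ϖ ^ d₀ := by
  rw [map_div₀, map_mul, hvσ, hvσ, v_inv_neg_det_diagonal_eq_one hd, hd i₀, one_mul, div_one, hiso j hj]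

/-- The `k`-coefficient of the value shape has valuation `|ϖ|^{d₀}` (close-pair gap EXACTLY `|ϖ|^{d₀+2s'}` divided by `|ϖ|^{2s'}`). [cite: Kottwitz1986, §3] -/
theorem v_shapeCoeff_k_eq (hvσ : ∀ a, Valued.v (σ a) = Valued.v a) (hϖ : Valued.v ϖ = WithZero.exp (-1 : ℤ)) {d : Fin 3 → K} (hd : ∀ i, Valued.v (d i) = 1)
    (s : Fin 3 → K) {i₀ j k : Fin 3} (hj : j ≠ i₀) (hk : k ≠ i₀) (hjk : j ≠ k) {d₀ s' : ℕ}
    (hgap : ∀ j k, j ≠ i₀ → k ≠ i₀ → j ≠ k → Valued.v (s j - s k) = Valued.v ϖ ^ (d₀ + 2 * s')) :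
    Valued.v ((s k - s j) / ((σ ϖ * ϖ) ^ s' * σ ((-(Matrix.diagonal d).det)⁻¹) * σ (d k))) = Valued.v ϖ ^ d₀ := by
  have hϖ0 : ϖ ≠ 0 := fun h0 => by rw [h0, map_zero] at hϖ; exact WithZero.coe_ne_zero hϖ.symm
  have hvϖ0 : Valued.v ϖ ≠ 0 := (Valuation.ne_zero_iff _).2 hϖ0
  rw [map_div₀, map_mul, map_mul, map_pow, map_mul, hvσ, hvσ, hvσ, v_inv_neg_det_diagonal_eq_one hd, hd k, mul_one, mul_one, hgap k j hk hj hjk.symm, pow_add, pow_mul,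
    pow_two, mul_div_assoc, div_self (pow_ne_zero _ (mul_ne_zero hvϖ0 hvϖ0)), mul_one]

/-! ## §8 The line test: the far side of a child of a region vertex is in the region iff its line lies in `ker λ̄ ∩ ker μ̄` -/

/-- **A FAR VERTEX MEETS ITS NEAR VERTEX IN THE CHILD.**  `v` self-dual, `x ∈ v`, `w ≠ v` a vertex containing the child `c_x = {z ∈ v | |⟨x, z⟩| < 1}`: then every vector of
`v ∩ w` lies in `c_x` — otherwise a `z ∈ v ∩ w` with `|⟨x,z⟩| ≥ 1` gives `y − (⟨x,y⟩∕⟨x,z⟩)z ∈ c_x ⊆ w` for all `y ∈ v`, so `v ≤ w`, `v = w`. [cite: Serre1980Trees, II.1.1] [cite: BruhatTits1972, §10] -/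
theorem v_pairing_lt_one_of_mem_inter_of_child_le (hσ : ∀ x, σ (σ x) = x) (hvσ : ∀ a, Valued.v (σ a) = Valued.v a)
    {v w : Submodule 𝒪[K] (Fin 3 → K)} (hv : IsSelfDualLattice σ ϖ ((StdForm.antidiagonal 3).over K) v) (hw : IsVertex σ ϖ ((StdForm.antidiagonal 3).over K) w)
    (hwv : w ≠ v) {x : Fin 3 → K} (hx : x ∈ v) (hcw : ∀ z ∈ v, Valued.v (pairing σ ((StdForm.antidiagonal 3).over K) x z) < 1 → z ∈ w)
    {z : Fin 3 → K} (hzv : z ∈ v) (hzw : z ∈ w) : Valued.v (pairing σ ((StdForm.antidiagonal 3).over K) x z) < 1 := by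
  by_contra hge
  rw [not_lt] at hge
  have hxz0 : pairing σ ((StdForm.antidiagonal 3).over K) x z ≠ 0 := fun h0 => by rw [h0, map_zero] at hge; exact not_lt.2 hge zero_lt_one
  have hint : ∀ {a b : Fin 3 → K}, a ∈ v → b ∈ v → Valued.v (pairing σ ((StdForm.antidiagonal 3).over K) a b) ≤ 1 := fun ha hb => by
    rw [pairing_antidiagonal]; exact v_B₀_le_one_of_isSelfDualLattice hσ hvσ hv ha hb
  -- every `y ∈ v` lies in `w`
  have hle : v ≤ w := by
    intro y hy
    set t : K := pairing σ ((StdForm.antidiagonal 3).over K) x y / pairing σ ((StdForm.antidiagonal 3).over K) x z with ht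
    have htv : Valued.v t ≤ 1 := by
      rw [ht, map_div₀]
      exact div_le_one_of_le₀ ((hint hx hy).trans hge) zero_le
    have hy' : y - t • z ∈ w := by
      refine hcw _ (v.sub_mem hy (smul_mem_of_v_le_one v htv hzv)) ?_
      rw [map_sub, map_smul, smul_eq_mul, ht, div_mul_cancel₀ _ hxz0, sub_self, map_zero]
      exact zero_lt_one
    have h := w.add_mem hy' (smul_mem_of_v_le_one w htv hzw)
    rwa [sub_add_cancel] at h
  obtain ⟨dw, hdw⟩ := hw
  exact hwv (le_antisymm (le_of_isSelfDualLattice_of_le hvσ isUnit_det_antidiagonal hv hdw hle) hle)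

/-- **THE LINE TEST («all digits or none»).**  `v` a self-dual vertex IN THE REGION (`LEV[v](ϖ^{d₀})`), `x ∈ v`, and `w ≠ v` a self-dual vertex containing the child
`c_x = {z ∈ v | |⟨x,z⟩| < 1}` (a far vertex of `v` through the line `x̄`).  THEN `w` is in the region iff **`|⟨x, u_{i₀}⟩| < 1 ∧ |⟨x, ϖ^{s'}u_k⟩| < 1`** — a condition on the
residual LINE `x̄` alone (`x̄ ∈ ker λ̄ ∩ ker μ̄`), the same for all `q` far vertices through it.  (⇐: `u_{i₀}, ϖ^{s'}u_k ∈ c_x ≤ w` and the criterion; ⇒: the criterion on `w` and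
`v ∩ w ≤ c_x`.) [cite: Kottwitz1986, §3] [cite: BruhatTits1972, §10] -/
theorem lev_iff_v_pairing_lt_one_of_child_le (hσ : ∀ x, σ (σ x) = x) (hvσ : ∀ a, Valued.v (σ a) = Valued.v a)
    (hϖ : Valued.v ϖ = WithZero.exp (-1 : ℤ)) (A : GL (Fin 3) K) {d : Fin 3 → K} (hd : ∀ i, Valued.v (d i) = 1)
    (hdA : Matrix.diagonal d = (-(Matrix.diagonal d).det) • formCongr σ A ((StdForm.antidiagonal 3).over K))
    (s : Fin 3 → K) {γm : Matrix (Fin 3) (Fin 3) K} (hγA : γm = (A : Matrix (Fin 3) (Fin 3) K) * Matrix.diagonal s * ((A⁻¹ : GL (Fin 3) K) : Matrix (Fin 3) (Fin 3) K))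
    (i₀ : Fin 3) {d₀ : ℕ} (he : ∀ i, Valued.v (s i - 1) ≤ Valued.v ϖ ^ d₀) (hiso : ∀ m, m ≠ i₀ → Valued.v (s i₀ - s m) = Valued.v ϖ ^ d₀) {s' : ℕ}
    (hgap : ∀ j k, j ≠ i₀ → k ≠ i₀ → j ≠ k → Valued.v (s j - s k) = Valued.v ϖ ^ (d₀ + 2 * s')) {k : Fin 3} (hk : k ≠ i₀)
    {v w : Submodule 𝒪[K] (Fin 3 → K)} (hv : IsSelfDualLattice σ ϖ ((StdForm.antidiagonal 3).over K) v)
    (hvR : v.map ((Matrix.toLin' (γm - 1)).restrictScalars 𝒪[K]) ≤ scaleLattice (ϖ ^ d₀) v)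
    (hw : IsSelfDualLattice σ ϖ ((StdForm.antidiagonal 3).over K) w) (hwv : w ≠ v) {x : Fin 3 → K} (hx : x ∈ v)
    (hcw : ∀ z ∈ v, Valued.v (pairing σ ((StdForm.antidiagonal 3).over K) x z) < 1 → z ∈ w) :
    w.map ((Matrix.toLin' (γm - 1)).restrictScalars 𝒪[K]) ≤ scaleLattice (ϖ ^ d₀) w ↔
      Valued.v (pairing σ ((StdForm.antidiagonal 3).over K) x ((A : Matrix (Fin 3) (Fin 3) K) *ᵥ Pi.single i₀ 1)) < 1 ∧
      Valued.v (pairing σ ((StdForm.antidiagonal 3).over K) x (ϖ ^ s' • ((A : Matrix (Fin 3) (Fin 3) K) *ᵥ Pi.single k 1))) < 1 := by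
  obtain ⟨hu, hK⟩ := (map_sub_one_le_scaleLattice_iff_mem_and_mem_of_isSelfDualLattice hσ hvσ hϖ A hd hdA s hγA i₀ he hiso hgap hv hk).1 hvR
  constructor
  · intro hwR
    obtain ⟨hu', hK'⟩ := (map_sub_one_le_scaleLattice_iff_mem_and_mem_of_isSelfDualLattice hσ hvσ hϖ A hd hdA s hγA i₀ he hiso hgap hw hk).1 hwR
    exact ⟨v_pairing_lt_one_of_mem_inter_of_child_le hσ hvσ hv ⟨0, hw⟩ hwv hx hcw hu hu', v_pairing_lt_one_of_mem_inter_of_child_le hσ hvσ hv ⟨0, hw⟩ hwv hx hcw hK hK'⟩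
  · rintro ⟨h₀, h₁⟩
    exact (map_sub_one_le_scaleLattice_iff_mem_and_mem_of_isSelfDualLattice hσ hvσ hϖ A hd hdA s hγA i₀ he hiso hgap hw hk).2 ⟨hcw _ hu h₀, hcw _ hK h₁⟩

/-! ## §9 The two spellings of the root-plane hyperbolicity token -/

/-- For unit `d_j, d_k`: `(∃ z, |z| ≤ 1 ∧ |d_j + zσ(z)d_k| < 1) ↔ (∃ t, |t| = 1 ∧ |d_j + tσ(t)d_k| < 1)` (a `z` with `|z| < 1` cannot cancel the unit `d_j`).
[cite: Kottwitz1986, §3] -/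
theorem exists_v_eq_one_iff_exists_v_le_one (hvσ : ∀ a, Valued.v (σ a) = Valued.v a) {d : Fin 3 → K} (hd : ∀ i, Valued.v (d i) = 1) (j k : Fin 3) :
    (∃ t : K, Valued.v t = 1 ∧ Valued.v (d j + t * σ t * d k) < 1) ↔ ∃ z : K, Valued.v z ≤ 1 ∧ Valued.v (d j + z * σ z * d k) < 1 := by
  constructor
  · rintro ⟨t, ht, h⟩; exact ⟨t, ht.le, h⟩
  · rintro ⟨z, hz, h⟩
    refine ⟨z, ?_, h⟩
    by_contra hne
    have hlt : Valued.v z < 1 := lt_of_le_of_ne hz hne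
    have hsmall : Valued.v (z * σ z * d k) < 1 := by
      rw [map_mul, map_mul, hvσ, hd k, mul_one]
      calc Valued.v z * Valued.v z ≤ Valued.v z * 1 := mul_le_mul' le_rfl hz
        _ = Valued.v z := mul_one _
        _ < 1 := hlt
    have heq : Valued.v (d j + z * σ z * d k) = 1 := by
      rw [Valuation.map_add_eq_of_lt_left _ (by rw [hd j]; exact hsmall), hd j]
    rw [heq] at h
    exact lt_irrefl _ h

/-! ## §10 (ED. 2) The line test in the junction's κ-keyed currency -/

/-- `|t| < 1 ↔ |t| ≤ |ϖ|` in the discretely valued `K` with `|ϖ| = exp(−1)`. [cite: Serre1980Trees, II.1.1] -/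
theorem v_lt_one_iff_v_le_v (hϖ : Valued.v ϖ = WithZero.exp (-1 : ℤ)) (t : K) : Valued.v t < 1 ↔ Valued.v t ≤ Valued.v ϖ := by
  have hϖ0 : ϖ ≠ 0 := fun h0 => by rw [h0, map_zero] at hϖ; exact WithZero.coe_ne_zero hϖ.symm
  have hvϖ0 : Valued.v ϖ ≠ 0 := (Valuation.ne_zero_iff _).2 hϖ0
  have h1 : (1 : ℤᵐ⁰) = Valued.v ϖ * WithZero.exp (1 : ℤ) := by rw [hϖ, ← WithZero.exp_add]; norm_num
  rw [h1]
  exact WithZero.lt_mul_exp_iff_le hvϖ0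

/-- **THE LINE TEST, κ-KEYED** (the junction's S3∕S45 children `(u·κ)·N₁` of the region vertex `v = u·r₀`, far vertex `w` self-dual adjacent to the child, `w ≠ v`):
`w` carries `LEV(ϖ^{d₀})` iff the child's line `x = (uκ)e₀` satisfies **`|⟨x, A e_{i₀}⟩| < 1 ∧ |⟨x, ϖ^{s'}·A e_k⟩| < 1`** — all `q` far vertices through the child or none (§8 +
★ `mem_mapGL_N₁_iff` transported by the vertex frame `u`). [cite: Kottwitz1986, §3] [cite: BruhatTits1972, §10] [cite: Serre1980Trees, II.1.1] -/
theorem lev_iff_v_pairing_lt_one_of_adj_keyed (hσ : ∀ x, σ (σ x) = x) (hvσ : ∀ a, Valued.v (σ a) = Valued.v a) (hσϖ : σ ϖ = -ϖ)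
    (hϖ : Valued.v ϖ = WithZero.exp (-1 : ℤ)) (A : GL (Fin 3) K) {d : Fin 3 → K} (hd : ∀ i, Valued.v (d i) = 1)
    (hdA : Matrix.diagonal d = (-(Matrix.diagonal d).det) • formCongr σ A ((StdForm.antidiagonal 3).over K))
    (s : Fin 3 → K) {γm : Matrix (Fin 3) (Fin 3) K} (hγA : γm = (A : Matrix (Fin 3) (Fin 3) K) * Matrix.diagonal s * ((A⁻¹ : GL (Fin 3) K) : Matrix (Fin 3) (Fin 3) K))
    (i₀ : Fin 3) {d₀ : ℕ} (he : ∀ i, Valued.v (s i - 1) ≤ Valued.v ϖ ^ d₀) (hiso : ∀ m, m ≠ i₀ → Valued.v (s i₀ - s m) = Valued.v ϖ ^ d₀) {s' : ℕ}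
    (hgap : ∀ j k, j ≠ i₀ → k ≠ i₀ → j ≠ k → Valued.v (s j - s k) = Valued.v ϖ ^ (d₀ + 2 * s')) {k : Fin 3} (hk : k ≠ i₀)
    (u : unitaryGroupOfForm σ ((StdForm.antidiagonal 3).over K)) {v : {M : Submodule 𝒪[K] (Fin 3 → K) // IsVertex σ ϖ ((StdForm.antidiagonal 3).over K) M}}
    (hvu : v = latticeGraphIso σ ϖ ((StdForm.antidiagonal 3).over K) u ⟨stdLattice K 3, 0, isSelfDualLattice_stdLattice_three_of_v hϖ⟩)
    (hvR : v.1.map ((Matrix.toLin' (γm - 1)).restrictScalars 𝒪[K]) ≤ scaleLattice (ϖ ^ d₀) v.1)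
    (κ : unitaryGroupOfForm σ ((StdForm.antidiagonal 3).over K)) (hκ : κ ∈ unitaryInt σ ((StdForm.antidiagonal 3).over K))
    {w : {M : Submodule 𝒪[K] (Fin 3 → K) // IsVertex σ ϖ ((StdForm.antidiagonal 3).over K) M}} (hw : IsSelfDualLattice σ ϖ ((StdForm.antidiagonal 3).over K) w.1) (hwv : w ≠ v)
    (hcw : (latticeGraph σ ϖ ((StdForm.antidiagonal 3).over K)).Adj
      (latticeGraphIso σ ϖ ((StdForm.antidiagonal 3).over K) (u * κ) ⟨latt (Matrix.diagonal ![(1 : K), 1, ϖ]), 2, isVertexLattice_two_N₁_of_neg hσϖ hϖ⟩) w) :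
    w.1.map ((Matrix.toLin' (γm - 1)).restrictScalars 𝒪[K]) ≤ scaleLattice (ϖ ^ d₀) w.1 ↔
      Valued.v (pairing σ ((StdForm.antidiagonal 3).over K) ((((u * κ : unitaryGroupOfForm σ ((StdForm.antidiagonal 3).over K)) : GL (Fin 3) K) : Matrix (Fin 3) (Fin 3) K) *ᵥ Pi.single 0 1)
          ((A : Matrix (Fin 3) (Fin 3) K) *ᵥ Pi.single i₀ 1)) < 1 ∧
      Valued.v (pairing σ ((StdForm.antidiagonal 3).over K) ((((u * κ : unitaryGroupOfForm σ ((StdForm.antidiagonal 3).over K)) : GL (Fin 3) K) : Matrix (Fin 3) (Fin 3) K) *ᵥ Pi.single 0 1)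
          (ϖ ^ s' • ((A : Matrix (Fin 3) (Fin 3) K) *ᵥ Pi.single k 1))) < 1 := by
  have hϖ0 : ϖ ≠ 0 := fun h0 => by rw [h0, map_zero] at hϖ; exact WithZero.coe_ne_zero hϖ.symm
  -- `v.1 = u·𝒪³` is self-dual and contains `x = (uκ)e₀`
  have hv1 : v.1 = mapGL (u : GL (Fin 3) K) (stdLattice K 3) := by rw [hvu]; rfl
  have hv : IsSelfDualLattice σ ϖ ((StdForm.antidiagonal 3).over K) v.1 := by
    rw [hv1]; exact isVertexLattice_mapGL σ ϖ ((StdForm.antidiagonal 3).over K) (u : GL (Fin 3) K) u.2 (isSelfDualLattice_stdLattice_three_of_v hϖ)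
  set x : Fin 3 → K := (((u * κ : unitaryGroupOfForm σ ((StdForm.antidiagonal 3).over K)) : GL (Fin 3) K) : Matrix (Fin 3) (Fin 3) K) *ᵥ Pi.single 0 1 with hxdef
  have hxu : x = ((u : GL (Fin 3) K) : Matrix (Fin 3) (Fin 3) K) *ᵥ ((((κ : GL (Fin 3) K) : Matrix (Fin 3) (Fin 3) K)) *ᵥ Pi.single 0 1) := by
    rw [hxdef, Matrix.mulVec_mulVec]; rfl
  have hκe : (((κ : GL (Fin 3) K) : Matrix (Fin 3) (Fin 3) K)) *ᵥ Pi.single 0 1 ∈ stdLattice K 3 :=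
    mulVec_mem_stdLattice_of_mem_unitaryInt hκ (by rw [mem_stdLattice]; intro i; by_cases hi : i = 0 <;> simp [hi])
  have hx : x ∈ v.1 := by
    rw [hv1, mem_mapGL_iff, hxu, Matrix.mulVec_mulVec, ← Units.val_mul, inv_mul_cancel, Units.val_one, Matrix.one_mulVec]
    exact hκe
  -- the child `(uκ)·N₁` lies in `w`, and it is `{z ∈ v | |⟨x,z⟩| ≤ |ϖ|}`
  have hcle : (latticeGraphIso σ ϖ ((StdForm.antidiagonal 3).over K) (u * κ) ⟨latt (Matrix.diagonal ![(1 : K), 1, ϖ]), 2, isVertexLattice_two_N₁_of_neg hσϖ hϖ⟩).1 ≤ w.1 := by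
    rcases (latticeGraph_adj_iff _ _ _ _ _).1 hcw with h | h
    · exact h.le
    · exact absurd h (not_lt_of_isSelfDualLattice hvσ isUnit_det_antidiagonal hw
        (latticeGraphIso σ ϖ ((StdForm.antidiagonal 3).over K) (u * κ) ⟨latt (Matrix.diagonal ![(1 : K), 1, ϖ]), 2, isVertexLattice_two_N₁_of_neg hσϖ hϖ⟩).2)
  have hchild : ∀ z ∈ v.1, Valued.v (pairing σ ((StdForm.antidiagonal 3).over K) x z) < 1 → z ∈ w.1 := by
    intro z hz hlt
    refine hcle ?_
    show z ∈ mapGL ((u * κ : unitaryGroupOfForm σ ((StdForm.antidiagonal 3).over K)) : GL (Fin 3) K) (latt (Matrix.diagonal ![(1 : K), 1, ϖ]))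
    rw [Subgroup.coe_mul, mapGL_mul, mem_mapGL_iff]
    have hz0 : (((u : GL (Fin 3) K)⁻¹ : GL (Fin 3) K) : Matrix (Fin 3) (Fin 3) K) *ᵥ z ∈ stdLattice K 3 := by
      rw [hv1, mem_mapGL_iff] at hz; exact hz
    rw [mem_mapGL_N₁_iff hκ hϖ0 hz0, ← pairing_antidiagonal, ← v_lt_one_iff_v_le_v hϖ]
    have hback : pairing σ ((StdForm.antidiagonal 3).over K) ((((κ : GL (Fin 3) K) : Matrix (Fin 3) (Fin 3) K)) *ᵥ Pi.single 0 1)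
        ((((u : GL (Fin 3) K)⁻¹ : GL (Fin 3) K) : Matrix (Fin 3) (Fin 3) K) *ᵥ z) = pairing σ ((StdForm.antidiagonal 3).over K) x z := by
      rw [← pairing_mulVec_mulVec_of_mem_unitary u.2, ← hxu, Matrix.mulVec_mulVec, ← Units.val_mul, mul_inv_cancel, Units.val_one, Matrix.one_mulVec]
    rw [hback]
    exact hlt
  have hwv' : w.1 ≠ v.1 := fun h => hwv (Subtype.ext h)
  exact lev_iff_v_pairing_lt_one_of_child_le hσ hvσ hϖ A hd hdA s hγA i₀ he hiso hgap hk hv hvR hw hwv' hx hchild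

end Literature.NumberTheory.Automorphic.UnitaryLatticeTree

end
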